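import Summits.QuantumFields.QCD.Theorems.SpectralDefectExtinctionWegnerEstimateStubResolventLocalSpectralSum
import Summits.QuantumFields.QCD.Theses.SpectralDefectExtinction
import Literature.MathematicalPhysics.QuantumFieldTheory.QCDPhaseQuenched
import Literature.MathematicalPhysics.QuantumFieldTheory.SpectralDefectDensity
import Literature.Barriers.QuantumFields.WilsonDeterminantMassSplitting

/-!
# Bridge lemma G toward stub `coareaWegner` of line `Sketch` (skeleton "ResolventCell", gen 2) for
crux `SpectralDefectExtinction.WegnerEstimate` (item stmt-QuantumFields-8966):
tail and weight bookkeeping — from the local resolvent trace to cut-off current sums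

The paper proof (Lines/Sketch.md §gen 2, 1-D route) starts from the mass-weighted spectral sum of
hypothesis `hspec` (= the landed `stub_resolventLocalSpectralSum`),
`t_P = Σ_{p ∈ P} Im ((A − iε)⁻¹)_{pp} = Σ_j w_j φ_ε(λ_j)`, `w_j = Σ_{p ∈ P} |u_j(p)|²`,
`φ_ε(E) = ε/(E² + ε²)`, and performs three elementary reductions before any analysis:

* `coareaWegner_spectralSum_tail_le` — THE TAIL: the modes with `|λ_j| > 1` contribute at most
  `#P` when `ε ≤ 1` (`φ_ε(λ) ≤ 1` there and `Σ_j |u_j(p)|² = 1` for each `p`, unitarity of the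
  eigenvector matrix), so `Σ_j w_j φ_ε(λ_j) ≤ #P + Σ_{|λ_j| ≤ 1} w_j φ_ε(λ_j)`;
* `coareaWegner_sum_le_boxMass` — THE WEIGHT: `w_j ≤ m_j`, the mass of `u_j` on any set of sites
  containing the sites of `P` (`boxMass`);
* `coareaWegner_spectralSum_le_currents` — RIGIDITY INSERTION: if every eigenvector `ψ` with
  `|λ| ≤ 1` obeys `c₀ b^k m(ψ) ≤ Σ_d |J_d(ψ)|` (hypothesis (ii) of `stub_currentRigidity` at a cell
  configuration with badness `b > 0`), then
  `Σ_j w_j φ_ε(λ_j) ≤ #P + (c₀ b^k)⁻¹ Σ_d Σ_{|λ_j| ≤ 1} |J_d(u_j)| φ_ε(λ_j)` — an `ℓ¹` sum over the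
  directions `d`, each of which is then treated along its own one-link circle.

All statements are abstract (a Hermitian matrix, a finite index set of directions, real-valued
"currents" `J_d` and "mass" `m`), in the vocabulary of `hspec` (Mathlib's `eigenvalues`,
`eigenvectorBasis`).
-/

noncomputable section

namespace Summit.QuantumFields.QCD.Cruxes.WegnerEstimate.ResolventCell

open MeasureTheory
open scoped Matrix BigOperators
open Literature.MathematicalPhysics.QuantumLattice Literature.MathematicalPhysics.QuantumFieldTheory
  Literature.Probability.LatticeModels
open Matrix
open scoped ComplexOrder

/-- The Wegner window is at most `1` off `[-1, 1]` when `ε ≤ 1`: `ε/(a² + ε²) ≤ 1` for `|a| > 1`. -/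
theorem coareaWegner_window_le_one {a ε : ℝ} (hε : 0 < ε) (hε1 : ε ≤ 1) (ha : 1 < |a|) :
    ε / (a ^ 2 + ε ^ 2) ≤ 1 := by
  have ha2 : 1 < a ^ 2 := by
    have h := (sq_lt_sq' (by linarith [abs_nonneg a]) ha)
    simpa using h
  rw [div_le_one (by positivity)]
  nlinarith [sq_nonneg ε]

/-- The Wegner window is non-negative. -/
theorem coareaWegner_window_nonneg (a : ℝ) {ε : ℝ} (hε : 0 < ε) : 0 ≤ ε / (a ^ 2 + ε ^ 2) := by
  positivity

/-- Rows of the eigenvector matrix are unit vectors: `Σ_j |u_j(p)|² = 1` for every index `p`. -/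
theorem coareaWegner_sum_normSq_eigenvectorBasis {n : Type*} [Fintype n] [DecidableEq n]
    {A : Matrix n n ℂ} (hA : A.IsHermitian) (p : n) :
    ∑ j, ‖(hA.eigenvectorBasis j) p‖ ^ 2 = 1 := by
  have hV2 : (hA.eigenvectorUnitary : Matrix n n ℂ) * star (hA.eigenvectorUnitary : Matrix n n ℂ) = 1 :=
    Unitary.mul_star_self_of_mem (hA.eigenvectorUnitary).2
  have h := localTraceRegular_row_normSq hV2 p
  simpa [Matrix.IsHermitian.eigenvectorUnitary_apply, Complex.normSq_eq_norm_sq] using h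

/-- **The tail.**  For a Hermitian `A`, a set of indices `P` and `0 < ε ≤ 1`, the modes with
`|λ_j| > 1` contribute at most `#P` to the mass-weighted spectral sum:
`Σ_j w_j φ_ε(λ_j) ≤ #P + Σ_j [|λ_j| ≤ 1] w_j φ_ε(λ_j)`, `w_j = Σ_{p ∈ P} |u_j(p)|²`. -/
theorem coareaWegner_spectralSum_tail_le {n : Type*} [Fintype n] [DecidableEq n]
    {A : Matrix n n ℂ} (hA : A.IsHermitian) (P : Finset n) {ε : ℝ} (hε : 0 < ε) (hε1 : ε ≤ 1) :
    ∑ j, (∑ p ∈ P, ‖(hA.eigenvectorBasis j) p‖ ^ 2) * (ε / (hA.eigenvalues j ^ 2 + ε ^ 2)) ≤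
      (P.card : ℝ) + ∑ j, if |hA.eigenvalues j| ≤ 1 then
        (∑ p ∈ P, ‖(hA.eigenvectorBasis j) p‖ ^ 2) * (ε / (hA.eigenvalues j ^ 2 + ε ^ 2)) else 0 := by
  set w : n → ℝ := fun j => ∑ p ∈ P, ‖(hA.eigenvectorBasis j) p‖ ^ 2 with hw
  set φ : n → ℝ := fun j => ε / (hA.eigenvalues j ^ 2 + ε ^ 2) with hφ
  have hw0 : ∀ j, 0 ≤ w j := fun j => Finset.sum_nonneg fun p _ => by positivity
  have hφ0 : ∀ j, 0 ≤ φ j := fun j => coareaWegner_window_nonneg _ hε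
  -- split each term according to `|λ_j| ≤ 1`
  have hsplit : ∀ j, w j * φ j ≤
      (if |hA.eigenvalues j| ≤ 1 then 0 else w j) + (if |hA.eigenvalues j| ≤ 1 then w j * φ j else 0) := by
    intro j
    split_ifs with h
    · simp
    · rw [add_zero]
      calc w j * φ j ≤ w j * 1 :=
            mul_le_mul_of_nonneg_left (coareaWegner_window_le_one hε hε1 (not_le.1 h)) (hw0 j)
        _ = w j := mul_one _
  -- the tail is at most `Σ_j w_j = #P`
  have htail : ∑ j, (if |hA.eigenvalues j| ≤ 1 then 0 else w j) ≤ (P.card : ℝ) := by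
    calc ∑ j, (if |hA.eigenvalues j| ≤ 1 then 0 else w j) ≤ ∑ j, w j :=
          Finset.sum_le_sum fun j _ => by split_ifs <;> simp [hw0 j]
      _ = ∑ p ∈ P, ∑ j, ‖(hA.eigenvectorBasis j) p‖ ^ 2 := Finset.sum_comm
      _ = ∑ p ∈ P, (1 : ℝ) := Finset.sum_congr rfl fun p _ => coareaWegner_sum_normSq_eigenvectorBasis hA p
      _ = (P.card : ℝ) := by simp
  calc ∑ j, w j * φ j
      ≤ ∑ j, ((if |hA.eigenvalues j| ≤ 1 then 0 else w j) +
          (if |hA.eigenvalues j| ≤ 1 then w j * φ j else 0)) := Finset.sum_le_sum fun j _ => hsplit j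
    _ = (∑ j, if |hA.eigenvalues j| ≤ 1 then 0 else w j) +
          ∑ j, (if |hA.eigenvalues j| ≤ 1 then w j * φ j else 0) := Finset.sum_add_distrib
    _ ≤ (P.card : ℝ) + ∑ j, (if |hA.eigenvalues j| ≤ 1 then w j * φ j else 0) := by
        gcongr

/-- **The weight.**  The `P`-weight of a vector is at most its mass on any set of sites `B` containing
the sites of `P`: `Σ_{p ∈ P} |v(p)|² ≤ boxMass v B`. -/
theorem coareaWegner_sum_le_boxMass {L : ℕ} [NeZero L] (v : QuarkIdx L → ℂ) (P : Finset (QuarkIdx L))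
    (B : Finset (TorusSite 4 L)) (hPB : ∀ p ∈ P, p.1 ∈ B) :
    ∑ p ∈ P, ‖v p‖ ^ 2 ≤ boxMass v B := by
  unfold boxMass
  refine Finset.sum_le_sum_of_subset_of_nonneg (fun p hp => ?_) fun _ _ _ => by positivity
  exact Finset.mem_filter.2 ⟨Finset.mem_univ _, hPB p hp⟩

/-- Mathlib's eigenvector basis vectors are eigenvectors in the `mulVec` form used by hypothesis
(ii) of `stub_currentRigidity` (complex scalar `λ_j`). -/
theorem coareaWegner_mulVec_eigenvectorBasis {n : Type*} [Fintype n] [DecidableEq n]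
    {A : Matrix n n ℂ} (hA : A.IsHermitian) (j : n) :
    A.mulVec ⇑(hA.eigenvectorBasis j) = ((hA.eigenvalues j : ℝ) : ℂ) • ⇑(hA.eigenvectorBasis j) := by
  rw [hA.mulVec_eigenvectorBasis j, RCLike.real_smul_eq_coe_smul (K := ℂ)]
  rfl

/-- **Rigidity insertion.**  Let `A` be Hermitian, `P` a set of indices, `0 < ε ≤ 1`, and suppose
every eigenvector `ψ` of `A` with eigenvalue `|λ| ≤ 1` satisfies the current/mass rigidity
`c₀ · b^k · m(ψ) ≤ Σ_d |J_d(ψ)|` with `c₀, b > 0` (hypothesis (ii) of `stub_currentRigidity` at a cell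
configuration of badness `b = bad > 0`), where the "mass" dominates the `P`-weight of the eigenbasis
(`Σ_{p ∈ P} |u_j(p)|² ≤ m(u_j)`, e.g. `m = boxMass · (x + box R')` with `x ∈ x + box R'`).  Then
`Σ_j w_j φ_ε(λ_j) ≤ #P + (c₀ b^k)⁻¹ · Σ_d Σ_j [|λ_j| ≤ 1] |J_d(u_j)| φ_ε(λ_j)`. -/
theorem coareaWegner_spectralSum_le_currents {n : Type*} [Fintype n] [DecidableEq n]
    {A : Matrix n n ℂ} (hA : A.IsHermitian) (P : Finset n) {ε c₀ b : ℝ} {k : ℕ} (hε : 0 < ε)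
    (hε1 : ε ≤ 1) (hc₀ : 0 < c₀) (hb : 0 < b) {D : Type*} [Fintype D] (J : D → (n → ℂ) → ℝ)
    (mass : (n → ℂ) → ℝ)
    (hmassP : ∀ j, ∑ p ∈ P, ‖(hA.eigenvectorBasis j) p‖ ^ 2 ≤ mass ⇑(hA.eigenvectorBasis j))
    (hrig : ∀ (ψ : n → ℂ) (lam : ℝ), |lam| ≤ 1 → A.mulVec ψ = (lam : ℂ) • ψ →
      c₀ * b ^ k * mass ψ ≤ ∑ d, |J d ψ|) :
    ∑ j, (∑ p ∈ P, ‖(hA.eigenvectorBasis j) p‖ ^ 2) * (ε / (hA.eigenvalues j ^ 2 + ε ^ 2)) ≤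
      (P.card : ℝ) + (c₀ * b ^ k)⁻¹ * ∑ d, ∑ j, if |hA.eigenvalues j| ≤ 1 then
        |J d ⇑(hA.eigenvectorBasis j)| * (ε / (hA.eigenvalues j ^ 2 + ε ^ 2)) else 0 := by
  have hcb : 0 < c₀ * b ^ k := mul_pos hc₀ (pow_pos hb k)
  refine (coareaWegner_spectralSum_tail_le hA P hε hε1).trans ?_
  refine add_le_add (le_refl (P.card : ℝ)) ?_
  rw [Finset.sum_comm, Finset.mul_sum]
  refine Finset.sum_le_sum fun j _ => ?_
  split_ifs with hj
  · -- a mode with `|λ_j| ≤ 1`: weight ≤ mass ≤ (c₀ b^k)⁻¹ Σ_d |J_d|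
    have hφ0 : 0 ≤ ε / (hA.eigenvalues j ^ 2 + ε ^ 2) := coareaWegner_window_nonneg _ hε
    have hm : mass ⇑(hA.eigenvectorBasis j) ≤ (c₀ * b ^ k)⁻¹ * ∑ d, |J d ⇑(hA.eigenvectorBasis j)| := by
      rw [le_inv_mul_iff₀ hcb]
      exact hrig _ _ hj (coareaWegner_mulVec_eigenvectorBasis hA j)
    calc (∑ p ∈ P, ‖(hA.eigenvectorBasis j) p‖ ^ 2) * (ε / (hA.eigenvalues j ^ 2 + ε ^ 2))
        ≤ ((c₀ * b ^ k)⁻¹ * ∑ d, |J d ⇑(hA.eigenvectorBasis j)|) * (ε / (hA.eigenvalues j ^ 2 + ε ^ 2)) :=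
          mul_le_mul_of_nonneg_right ((hmassP j).trans hm) hφ0
      _ = (c₀ * b ^ k)⁻¹ * ∑ d, |J d ⇑(hA.eigenvectorBasis j)| * (ε / (hA.eigenvalues j ^ 2 + ε ^ 2)) := by
          rw [mul_assoc, Finset.sum_mul]
  · simp

/-- The cut-off current sums are non-negative. -/
theorem coareaWegner_currentSum_nonneg {n : Type*} [Fintype n] [DecidableEq n]
    {A : Matrix n n ℂ} (hA : A.IsHermitian) {ε : ℝ} (hε : 0 < ε) {D : Type*} [Fintype D]
    (J : D → (n → ℂ) → ℝ) (d : D) :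
    0 ≤ ∑ j, (if |hA.eigenvalues j| ≤ 1 then
        |J d ⇑(hA.eigenvectorBasis j)| * (ε / (hA.eigenvalues j ^ 2 + ε ^ 2)) else 0) :=
  Finset.sum_nonneg fun j _ => by
    split_ifs
    · exact mul_nonneg (abs_nonneg _) (coareaWegner_window_nonneg _ hε)
    · exact le_rfl

/-- The mass-weighted spectral sum is non-negative (so the local resolvent trace of `hspec` is). -/
theorem coareaWegner_spectralSum_nonneg {n : Type*} [Fintype n] [DecidableEq n]
    {A : Matrix n n ℂ} (hA : A.IsHermitian) (P : Finset n) {ε : ℝ} (hε : 0 < ε) :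
    0 ≤ ∑ j, (∑ p ∈ P, ‖(hA.eigenvectorBasis j) p‖ ^ 2) * (ε / (hA.eigenvalues j ^ 2 + ε ^ 2)) :=
  Finset.sum_nonneg fun j _ => mul_nonneg (Finset.sum_nonneg fun p _ => by positivity)
    (coareaWegner_window_nonneg _ hε)

/-! ### The pointwise bound for the Wilson operator, in the verbatim shapes of the registered signature -/

set_option maxHeartbeats 400000 in
/-- **Pointwise bound on the local resolvent trace (tail + weight + rigidity).**  For any gauge field
`W` on the four-torus of side `L ≥ 1`, a site `x`, `0 < ε ≤ 1`, and constants `c₀, b > 0`, IF the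
local spectral identity `hspec` (= the landed `stub_resolventLocalSpectralSum`) holds and every
eigenvector `ψ` of `H = Γ₅ D_W(W, m₀, 1)` with eigenvalue `|λ| ≤ 1` obeys the current/mass rigidity of
hypothesis (ii) of `stub_currentRigidity` with badness value `b` (verbatim: mass on `x + box R'`,
currents through the links `(x + y, μ)`, `y ∈ box 4 R`, in the eight `su(3)` basis directions), THEN
`t_x = Σ_{a,α} Im ((H − iε)⁻¹)_{(x,a,α),(x,a,α)}
  ≤ 12 + (c₀ b^k)⁻¹ · Σ_{y ∈ box R} Σ_μ Σ_i Σ_j [|λ_j| ≤ 1] |J_{(x+y,μ),Xᵢ}(u_j)| φ_ε(λ_j)`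
for Mathlib's eigenpairs `(λ_j, u_j)` of `H` (`12 = #{(x, a, α)}`; `x ∈ x + box R'`). -/
theorem coareaWegner_localTrace_pointwise
    (hspec : ∀ (n : Type) [Fintype n] [DecidableEq n] (A : Matrix n n ℂ) (hA : A.IsHermitian) (P : Finset n) (ε : ℝ),
      0 < ε →
      ∑ p ∈ P, ((A - ((ε : ℂ) * Complex.I) • (1 : Matrix n n ℂ))⁻¹ p p).im =
        ∑ j : n, (∑ p ∈ P, ‖(hA.eigenvectorBasis j) p‖ ^ 2) * (ε / (hA.eigenvalues j ^ 2 + ε ^ 2)))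
    {L : ℕ} [NeZero L] (x : TorusSite 4 L) (W : GaugeConfig 4 L SU3) (m₀ : ℝ) {ε c₀ b : ℝ} {R R' k : ℕ}
    (hε : 0 < ε) (hε1 : ε ≤ 1) (hc₀ : 0 < c₀) (hb : 0 < b)
    (hH : (spinorLift gammaFive * wilsonDirac (fundamentalRep (Fin 3)) W m₀ 1).IsHermitian)
    (hrigW : ∀ (ψ : QuarkIdx L → ℂ) (lam : ℝ), |lam| ≤ 1 →
      (spinorLift gammaFive * wilsonDirac (fundamentalRep (Fin 3)) W m₀ 1).mulVec ψ = (lam : ℂ) • ψ →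
      c₀ * b ^ k * boxMass ψ ((box 4 R').image fun y => x + Torus.proj L y) ≤
        ∑ y ∈ box 4 R, ∑ μ : Fin 4, ∑ i : Fin 8,
          |2 * (∑ a : Fin 3, ∑ b : Fin 3, ∑ α : Fin 4, ∑ β : Fin 4,
            star (ψ (x + Torus.proj L y, a, α)) *
              (gammaFive * ((-(1 / 2 : ℂ)) • ((1 : Matrix (Fin 4) (Fin 4) ℂ) - euclideanGamma μ))) α β *
              (((W (x + Torus.proj L y, μ) : SU3) : Matrix (Fin 3) (Fin 3) ℂ) *
                  (![!![0, 1, 0; -1, 0, 0; 0, 0, 0], !![0, 0, 1; 0, 0, 0; -1, 0, 0],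
                     !![0, 0, 0; 0, 0, 1; 0, -1, 0], !![0, Complex.I, 0; Complex.I, 0, 0; 0, 0, 0],
                     !![0, 0, Complex.I; 0, 0, 0; Complex.I, 0, 0],
                     !![0, 0, 0; 0, 0, Complex.I; 0, Complex.I, 0],
                     !![Complex.I, 0, 0; 0, -Complex.I, 0; 0, 0, 0],
                     !![0, 0, 0; 0, Complex.I, 0; 0, 0, -Complex.I]] i : Matrix (Fin 3) (Fin 3) ℂ)) a b *
              ψ (Literature.MathematicalPhysics.QuantumFieldTheory.Site.shift (x + Torus.proj L y) μ,
                b, β)).re|) :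
    ∑ a : Fin 3, ∑ α : Fin 4,
      (((spinorLift gammaFive * wilsonDirac (fundamentalRep (Fin 3)) W m₀ 1 -
        ((ε : ℂ) * Complex.I) • (1 : Matrix (QuarkIdx L) (QuarkIdx L) ℂ))⁻¹ :
          Matrix (QuarkIdx L) (QuarkIdx L) ℂ) (x, a, α) (x, a, α)).im ≤
      12 + (c₀ * b ^ k)⁻¹ * ∑ y ∈ box 4 R, ∑ μ : Fin 4, ∑ i : Fin 8, ∑ j : QuarkIdx L,
        if |hH.eigenvalues j| ≤ 1 then
          |2 * (∑ a : Fin 3, ∑ b : Fin 3, ∑ α : Fin 4, ∑ β : Fin 4,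
            star ((hH.eigenvectorBasis j).ofLp (x + Torus.proj L y, a, α)) *
              (gammaFive * ((-(1 / 2 : ℂ)) • ((1 : Matrix (Fin 4) (Fin 4) ℂ) - euclideanGamma μ))) α β *
              (((W (x + Torus.proj L y, μ) : SU3) : Matrix (Fin 3) (Fin 3) ℂ) *
                  (![!![0, 1, 0; -1, 0, 0; 0, 0, 0], !![0, 0, 1; 0, 0, 0; -1, 0, 0],
                     !![0, 0, 0; 0, 0, 1; 0, -1, 0], !![0, Complex.I, 0; Complex.I, 0, 0; 0, 0, 0],
                     !![0, 0, Complex.I; 0, 0, 0; Complex.I, 0, 0],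
                     !![0, 0, 0; 0, 0, Complex.I; 0, Complex.I, 0],
                     !![Complex.I, 0, 0; 0, -Complex.I, 0; 0, 0, 0],
                     !![0, 0, 0; 0, Complex.I, 0; 0, 0, -Complex.I]] i : Matrix (Fin 3) (Fin 3) ℂ)) a b *
              (hH.eigenvectorBasis j).ofLp (Literature.MathematicalPhysics.QuantumFieldTheory.Site.shift (x + Torus.proj L y) μ,
                b, β)).re| * (ε / (hH.eigenvalues j ^ 2 + ε ^ 2))
        else 0 := by
  -- abbreviations
  set A : Matrix (QuarkIdx L) (QuarkIdx L) ℂ :=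
    spinorLift gammaFive * wilsonDirac (fundamentalRep (Fin 3)) W m₀ 1 with hAdef
  set Jf : ((↥(box 4 R) × Fin 4) × Fin 8) → (QuarkIdx L → ℂ) → ℝ := fun d ψ =>
    2 * (∑ a : Fin 3, ∑ b : Fin 3, ∑ α : Fin 4, ∑ β : Fin 4,
            star (ψ (x + Torus.proj L d.1.1, a, α)) *
              (gammaFive * ((-(1 / 2 : ℂ)) • ((1 : Matrix (Fin 4) (Fin 4) ℂ) - euclideanGamma d.1.2))) α β *
              (((W (x + Torus.proj L d.1.1, d.1.2) : SU3) : Matrix (Fin 3) (Fin 3) ℂ) *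
                  (![!![0, 1, 0; -1, 0, 0; 0, 0, 0], !![0, 0, 1; 0, 0, 0; -1, 0, 0],
                     !![0, 0, 0; 0, 0, 1; 0, -1, 0], !![0, Complex.I, 0; Complex.I, 0, 0; 0, 0, 0],
                     !![0, 0, Complex.I; 0, 0, 0; Complex.I, 0, 0],
                     !![0, 0, 0; 0, 0, Complex.I; 0, Complex.I, 0],
                     !![Complex.I, 0, 0; 0, -Complex.I, 0; 0, 0, 0],
                     !![0, 0, 0; 0, Complex.I, 0; 0, 0, -Complex.I]] d.2 : Matrix (Fin 3) (Fin 3) ℂ)) a b *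
              ψ (Literature.MathematicalPhysics.QuantumFieldTheory.Site.shift (x + Torus.proj L d.1.1) d.1.2,
                b, β)).re with hJf
  set mass : (QuarkIdx L → ℂ) → ℝ := fun ψ => boxMass ψ ((box 4 R').image fun y => x + Torus.proj L y)
    with hmass
  set P : Finset (QuarkIdx L) := (Finset.univ : Finset (Fin 3 × Fin 4)).image
    (fun aα => ((x, aα.1, aα.2) : QuarkIdx L)) with hP
  have hinj : Function.Injective (fun aα : Fin 3 × Fin 4 => ((x, aα.1, aα.2) : QuarkIdx L)) := by
    intro p q h
    simp only [Prod.mk.injEq, true_and] at h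
    exact Prod.ext h.1 h.2
  have hsumP : ∀ g : QuarkIdx L → ℝ, ∑ p ∈ P, g p = ∑ a : Fin 3, ∑ α : Fin 4, g (x, a, α) := by
    intro g
    rw [hP, Finset.sum_image (fun p _ q _ h => hinj h), Fintype.sum_prod_type]
  have hcardP : (P.card : ℝ) = 12 := by
    rw [hP, Finset.card_image_of_injective _ hinj]
    simp
  -- the `P`-weight is dominated by the mass on `x + box R'` (`x = x + proj 0`, `0 ∈ box R'`)
  have hx : x ∈ (box 4 R').image fun y => x + Torus.proj L y := by
    refine Finset.mem_image.2 ⟨0, zero_mem_box 4 R', ?_⟩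
    have : Torus.proj L (0 : Fin 4 → ℤ) = 0 := by
      funext i
      simp [Torus.proj]
    rw [this, add_zero]
  have hmassP : ∀ j, ∑ p ∈ P, ‖(hH.eigenvectorBasis j) p‖ ^ 2 ≤ mass ⇑(hH.eigenvectorBasis j) := by
    intro j
    refine coareaWegner_sum_le_boxMass _ P _ fun p hp => ?_
    obtain ⟨aα, -, rfl⟩ := Finset.mem_image.1 hp
    exact hx
  -- rigidity in the abstract shape (directions indexed by the finite type `(box R × Fin 4) × Fin 8`)
  have hrig' : ∀ (ψ : QuarkIdx L → ℂ) (lam : ℝ), |lam| ≤ 1 → A.mulVec ψ = (lam : ℂ) • ψ →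
      c₀ * b ^ k * mass ψ ≤ ∑ d, |Jf d ψ| := by
    intro ψ lam hlam hψ
    have h := hrigW ψ lam hlam hψ
    rw [← Finset.sum_coe_sort (box 4 R), ← Fintype.sum_prod_type', ← Fintype.sum_prod_type'] at h
    exact h
  -- pass to the direction-indexed form of the right-hand side
  conv_rhs => rw [← Finset.sum_coe_sort (box 4 R), ← Fintype.sum_prod_type', ← Fintype.sum_prod_type']
  calc ∑ a : Fin 3, ∑ α : Fin 4,
        ((A - ((ε : ℂ) * Complex.I) • (1 : Matrix (QuarkIdx L) (QuarkIdx L) ℂ))⁻¹ (x, a, α) (x, a, α)).im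
      = ∑ p ∈ P, ((A - ((ε : ℂ) * Complex.I) • (1 : Matrix (QuarkIdx L) (QuarkIdx L) ℂ))⁻¹ p p).im :=
        (hsumP fun p => ((A - ((ε : ℂ) * Complex.I) • (1 : Matrix (QuarkIdx L) (QuarkIdx L) ℂ))⁻¹ p p).im).symm
    _ = ∑ j, (∑ p ∈ P, ‖(hH.eigenvectorBasis j) p‖ ^ 2) * (ε / (hH.eigenvalues j ^ 2 + ε ^ 2)) :=
        hspec (QuarkIdx L) A hH P ε hε
    _ ≤ (P.card : ℝ) + (c₀ * b ^ k)⁻¹ * ∑ d, ∑ j, (if |hH.eigenvalues j| ≤ 1 then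
          |Jf d ⇑(hH.eigenvectorBasis j)| * (ε / (hH.eigenvalues j ^ 2 + ε ^ 2)) else 0) :=
        coareaWegner_spectralSum_le_currents hH P hε hε1 hc₀ hb Jf mass hmassP hrig'
    _ = 12 + (c₀ * b ^ k)⁻¹ * ∑ d, ∑ j, (if |hH.eigenvalues j| ≤ 1 then
          |Jf d ⇑(hH.eigenvectorBasis j)| * (ε / (hH.eigenvalues j ^ 2 + ε ^ 2)) else 0) := by
        rw [hcardP]

end Summit.QuantumFields.QCD.Cruxes.WegnerEstimate.ResolventCell

end
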